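import Mathlib
import Summits.Ventures.DiscreteObjects.Mahler.CensusAuxiliaryCuts

/-!
# Auxiliary-function cuts in the coordinates `(u, w) = (r + 1/r, 2 cos θ)` (venture `DiscreteObjects`, target L)

Cell `pub-namedobj`, seat `pub-namedobj-mahler-g14`. Framing: lottery ticket; floor = certified bounds/negative
ranges.

The hypothesis (H) = `AuxBound a qs B m₀ c` of `CensusAuxiliaryCuts` quantifies over complex `z` in an annulus.  For a
certificate by RATIONAL interval arithmetic we pass to the real coordinates `u = ‖z‖ + ‖z‖⁻¹ ∈ [2, B + B⁻¹]` and
`w = 2 Re z / ‖z‖ ∈ [-2, 2]`, in which every ingredient of the auxiliary function is a polynomial: with the Chebyshev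
polynomials `C_m` (`C₀ = 2`, `C₁ = x`, `C_{m+2} = x C_{m+1} - C_m`, so `C_m(x + x⁻¹) = x^m + x^{-m}`, `chebC_add_inv`)

* `re_pow_add_inv_pow_eq_chebC`: `Re(z^k + z^{-k}) = ½ C_k(u) C_k(w)`;
* `norm_sq_qhat_eq_hUW`: `‖q̂_v(z)‖² = H_v(u, w) := Σ_{k,l ≤ L} c_k c_l ½ (C_{k+l}(u) C_{|k-l|}(w) + C_{|k-l|}(u) C_{k+l}(w))`,
  `c₀ = λ₀/2`, `c_k = λ_k/2` (from the Laurent identity `q̂_v(z) = Σ_k c_k (z^k + z^{-k})`);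
* `auxBound_of_uw`: (H) follows from the real inequality
  `-m₀ - c √(u - 2) ≤ Σ_k a_k C_k(u) C_k(w) / 4 - Σ_j (e_j/2) log H_j(u, w)` on the rectangle (where all `H_j > 0`).

The rectangle inequality is what a kernel checker (dyadic interval arithmetic, Taylor forms in `w`, monotonicity in `u`;
successor work) certifies; `chebC` is computable.
-/

namespace Summit.Ventures.DiscreteObjects.Mahler

open Polynomial

/-! ## Chebyshev `C` by recurrence -/

/-- `C₀ = 2`, `C₁ = x`, `C_{m+2} = x·C_{m+1} - C_m` (Chebyshev polynomials of the first kind, "Dickson" normalisation). -/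
def chebC {R : Type*} [Ring R] : ℕ → R → R
  | 0, _ => 2
  | 1, x => x
  | m + 2, x => x * chebC (m + 1) x - chebC m x

/-- `C_m(x + x⁻¹) = x^m + x^{-m}`. -/
theorem chebC_add_inv {K : Type*} [Field K] {x : K} (hx : x ≠ 0) :
    ∀ m : ℕ, chebC m (x + x⁻¹) = x ^ m + x⁻¹ ^ m
  | 0 => by simp [chebC]; norm_num
  | 1 => by simp [chebC]
  | m + 2 => by
    rw [chebC, chebC_add_inv hx (m + 1), chebC_add_inv hx m, inv_pow, inv_pow, inv_pow]
    field_simp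
    ring

/-- `chebC` commutes with ring homomorphisms. -/
theorem map_chebC {R S : Type*} [Ring R] [Ring S] (f : R →+* S) (x : R) :
    ∀ m : ℕ, f (chebC m x) = chebC m (f x)
  | 0 => by simp [chebC, map_ofNat]
  | 1 => by simp [chebC]
  | m + 2 => by rw [chebC, chebC, map_sub, map_mul, map_chebC f x (m + 1), map_chebC f x m]

/-- Real-to-complex cast of `chebC`. -/
theorem chebC_ofReal (x : ℝ) (m : ℕ) : ((chebC m x : ℝ) : ℂ) = chebC m (x : ℂ) :=
  map_chebC Complex.ofRealHom x m

/-! ## The two identities -/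

/-- For a unit `ω`: `Re ω^m = ½ C_m(2 Re ω)`. -/
theorem re_pow_unit_eq_chebC {ω : ℂ} (hω : ‖ω‖ = 1) (m : ℕ) : (ω ^ m).re = chebC m (2 * ω.re) / 2 := by
  have hω0 : ω ≠ 0 := by rintro rfl; simp at hω
  have hinv : ω⁻¹ = (starRingEnd ℂ) ω := by
    rw [Complex.inv_def, Complex.normSq_eq_norm_sq, hω]; simp
  have h := chebC_add_inv hω0 m
  have hsum : ω + ω⁻¹ = ((2 * ω.re : ℝ) : ℂ) := by
    rw [hinv, Complex.add_conj]
  rw [hsum, ← chebC_ofReal] at h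
  have hre := congrArg Complex.re h
  rw [Complex.ofReal_re, Complex.add_re, hinv, ← map_pow, Complex.conj_re] at hre
  linarith

/-- **`Re(z^k + z^{-k}) = ½ C_k(‖z‖ + ‖z‖⁻¹) · C_k(2 Re z/‖z‖)`** for `z ≠ 0`. -/
theorem re_pow_add_inv_pow_eq_chebC {z : ℂ} (hz : z ≠ 0) (k : ℕ) :
    (z ^ k + z⁻¹ ^ k).re = chebC k (‖z‖ + ‖z‖⁻¹) * chebC k (2 * (z.re / ‖z‖)) / 2 := by
  have hr : 0 < ‖z‖ := norm_pos_iff.mpr hz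
  rw [re_pow_add_inv_pow hz k]
  set ω : ℂ := ((‖z‖⁻¹ : ℝ) : ℂ) * z with hω
  have hωn : ‖ω‖ = 1 := by
    rw [hω, norm_mul, Complex.norm_real, Real.norm_eq_abs, abs_of_pos (inv_pos.mpr hr), inv_mul_cancel₀ hr.ne']
  have hωre : ω.re = z.re / ‖z‖ := by
    rw [hω, Complex.re_ofReal_mul]; ring
  rw [re_pow_unit_eq_chebC hωn k, hωre, ← inv_pow, ← chebC_add_inv hr.ne' k]
  ring

/-- The half-autocorrelation coefficients `c₀ = λ₀/2`, `c_k = λ_k/2`. -/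
noncomputable def lamHalf (v : List ℝ) (k : ℕ) : ℝ := if k = 0 then lamZero v / 2 else lamAt v k / 2

/-- `H_v(u, w) = Σ_{k,l ≤ L} c_k c_l ½ (C_{k+l}(u) C_{|k-l|}(w) + C_{|k-l|}(u) C_{k+l}(w))`, `L = |v| - 1`. -/
noncomputable def hUW (v : List ℝ) (u w : ℝ) : ℝ :=
  ∑ k ∈ Finset.range v.length, ∑ l ∈ Finset.range v.length,
    lamHalf v k * lamHalf v l * ((chebC (k + l) u * chebC (Nat.dist k l) w + chebC (Nat.dist k l) u * chebC (k + l) w) / 2)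

/-- `q̂(z) = Σ_{k ≤ L} c_k (z^k + z^{-k})` (the Laurent identity regrouped with `c₀ (z⁰ + z⁰) = λ₀`). -/
theorem laurent_vEval_lamHalf (v : List ℝ) {z : ℂ} (hz : z ≠ 0) (hv : v ≠ []) :
    vEval v z * vEval v z⁻¹ = ∑ k ∈ Finset.range v.length, ((lamHalf v k : ℝ) : ℂ) * (z ^ k + z⁻¹ ^ k) := by
  obtain ⟨n, hn⟩ : ∃ n, v.length = n + 1 := ⟨v.length - 1, by
    have := List.length_pos_of_ne_nil hv; omega⟩
  have hR : ∑ k ∈ Finset.range v.length, ((lamHalf v k : ℝ) : ℂ) * (z ^ k + z⁻¹ ^ k) =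
      ((lamZero v : ℝ) : ℂ) + ∑ k ∈ Finset.range n, ((lamAt v (k + 1) / 2 : ℝ) : ℂ) * (z ^ (k + 1) + z⁻¹ ^ (k + 1)) := by
    rw [hn, Finset.sum_range_succ']
    simp only [lamHalf, Nat.add_one_ne_zero, if_false, if_true, pow_zero]
    push_cast; ring
  have hL : ∑ k ∈ Finset.range v.length, ((lamAt v (k + 1) / 2 : ℝ) : ℂ) * (z ^ (k + 1) + z⁻¹ ^ (k + 1)) =
      ∑ k ∈ Finset.range n, ((lamAt v (k + 1) / 2 : ℝ) : ℂ) * (z ^ (k + 1) + z⁻¹ ^ (k + 1)) := by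
    rw [hn, Finset.sum_range_succ, lamAt_eq_zero_of_le v (by omega)]
    simp
  rw [laurent_vEval v hz, hL, hR]

/-- The pair identity: `Re((z^k + z^{-k}) · conj(z^l + z^{-l})) = ½ (C_{k+l}(u) C_{|k-l|}(w) + C_{|k-l|}(u) C_{k+l}(w))`. -/
theorem re_X_mul_conj_X {z : ℂ} (hz : z ≠ 0) (k l : ℕ) :
    ((z ^ k + z⁻¹ ^ k) * (starRingEnd ℂ) (z ^ l + z⁻¹ ^ l)).re =
      (chebC (k + l) (‖z‖ + ‖z‖⁻¹) * chebC (Nat.dist k l) (2 * (z.re / ‖z‖)) +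
        chebC (Nat.dist k l) (‖z‖ + ‖z‖⁻¹) * chebC (k + l) (2 * (z.re / ‖z‖))) / 2 := by
  -- polar form `z = r ω`
  have hr : 0 < ‖z‖ := norm_pos_iff.mpr hz
  set r : ℝ := ‖z‖ with hrdef
  set ω : ℂ := ((r⁻¹ : ℝ) : ℂ) * z with hω
  have hωn : ‖ω‖ = 1 := by
    rw [hω, norm_mul, Complex.norm_real, Real.norm_eq_abs, abs_of_pos (inv_pos.mpr hr), inv_mul_cancel₀ hr.ne']
  have hω0 : ω ≠ 0 := by rintro h; rw [h] at hωn; simp at hωn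
  have hωre : ω.re = z.re / r := by rw [hω, Complex.re_ofReal_mul]; ring
  have hz' : z = ((r : ℝ) : ℂ) * ω := by
    rw [hω, ← mul_assoc, ← Complex.ofReal_mul, mul_inv_cancel₀ hr.ne', Complex.ofReal_one, one_mul]
  have hωinv : ω⁻¹ = (starRingEnd ℂ) ω := by
    rw [Complex.inv_def, Complex.normSq_eq_norm_sq, hωn]; simp
  have hconjω : (starRingEnd ℂ) ω = ω⁻¹ := hωinv.symm
  -- real parts of unit powers
  have hRe : ∀ m : ℕ, (ω ^ m).re = chebC m (2 * (z.re / r)) / 2 := fun m => by rw [← hωre]; exact re_pow_unit_eq_chebC hωn m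
  have hReinv : ∀ m : ℕ, (ω⁻¹ ^ m).re = chebC m (2 * (z.re / r)) / 2 := fun m => by
    rw [hωinv, ← map_pow, Complex.conj_re]; exact hRe m
  -- `C(u)` values
  have hr0 : (r : ℝ) ≠ 0 := hr.ne'
  have hCsum : chebC (k + l) (r + r⁻¹) = r ^ (k + l) + r⁻¹ ^ (k + l) := chebC_add_inv hr0 (k + l)
  -- expand the product in terms of `r` and `ω`
  have hzk : ∀ m : ℕ, z ^ m = ((r ^ m : ℝ) : ℂ) * ω ^ m := fun m => by rw [hz', mul_pow, Complex.ofReal_pow]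
  have hzik : ∀ m : ℕ, z⁻¹ ^ m = ((r⁻¹ ^ m : ℝ) : ℂ) * ω⁻¹ ^ m := fun m => by
    rw [hz', mul_inv, mul_pow, ← Complex.ofReal_inv, Complex.ofReal_pow]
  rw [hzk k, hzik k, hzk l, hzik l, map_add, map_mul, map_mul, Complex.conj_ofReal, Complex.conj_ofReal, map_pow, map_pow,
    hconjω, map_inv₀, hconjω, inv_inv]
  -- now a sum of four terms `real * unit-power products`
  rcases le_total l k with hlk | hkl
  · have hd : Nat.dist k l = k - l := by rw [Nat.dist_comm]; exact Nat.dist_eq_sub_of_le hlk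
    obtain ⟨e, rfl⟩ := Nat.exists_eq_add_of_le hlk
    rw [hd, Nat.add_sub_cancel_left]
    have hCdiff : chebC e (r + r⁻¹) = r ^ e + r⁻¹ ^ e := chebC_add_inv hr0 e
    -- unit-power products
    have p1 : ω ^ (l + e) * ω⁻¹ ^ l = ω ^ e := by
      rw [pow_add, inv_pow]; field_simp
    have p2 : ω ^ (l + e) * ω ^ l = ω ^ (l + e + l) := by ring
    have p3 : ω⁻¹ ^ (l + e) * ω⁻¹ ^ l = ω⁻¹ ^ (l + e + l) := by ring
    have p4 : ω⁻¹ ^ (l + e) * ω ^ l = ω⁻¹ ^ e := by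
      rw [pow_add, inv_pow, inv_pow]; field_simp
    have expand : (((r ^ (l + e) : ℝ) : ℂ) * ω ^ (l + e) + ((r⁻¹ ^ (l + e) : ℝ) : ℂ) * ω⁻¹ ^ (l + e)) *
        (((r ^ l : ℝ) : ℂ) * ω⁻¹ ^ l + ((r⁻¹ ^ l : ℝ) : ℂ) * ω ^ l) =
        ((r ^ (l + e) * r ^ l : ℝ) : ℂ) * (ω ^ (l + e) * ω⁻¹ ^ l) + ((r ^ (l + e) * r⁻¹ ^ l : ℝ) : ℂ) * (ω ^ (l + e) * ω ^ l) +
          ((r⁻¹ ^ (l + e) * r ^ l : ℝ) : ℂ) * (ω⁻¹ ^ (l + e) * ω⁻¹ ^ l) +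
          ((r⁻¹ ^ (l + e) * r⁻¹ ^ l : ℝ) : ℂ) * (ω⁻¹ ^ (l + e) * ω ^ l) := by
      push_cast; ring
    rw [expand, p1, p2, p3, p4]
    simp only [Complex.add_re, Complex.re_ofReal_mul]
    rw [hRe e, hRe (l + e + l), hReinv (l + e + l), hReinv e, show l + e + l = (l + e) + l from rfl, hCsum, hCdiff]
    have q1 : r ^ (l + e) * r⁻¹ ^ l = r ^ e := by rw [pow_add, inv_pow]; field_simp
    have q2 : r⁻¹ ^ (l + e) * r ^ l = r⁻¹ ^ e := by rw [pow_add, inv_pow, inv_pow]; field_simp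
    have q3 : r ^ (l + e) * r ^ l = r ^ (l + e + l) := by ring
    have q4 : r⁻¹ ^ (l + e) * r⁻¹ ^ l = r⁻¹ ^ (l + e + l) := by ring
    rw [q1, q2, q3, q4]
    ring
  · have hd : Nat.dist k l = l - k := Nat.dist_eq_sub_of_le hkl
    obtain ⟨e, rfl⟩ := Nat.exists_eq_add_of_le hkl
    rw [hd, Nat.add_sub_cancel_left]
    have hCdiff : chebC e (r + r⁻¹) = r ^ e + r⁻¹ ^ e := chebC_add_inv hr0 e
    have p1 : ω ^ k * ω⁻¹ ^ (k + e) = ω⁻¹ ^ e := by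
      rw [pow_add, inv_pow, inv_pow]; field_simp
    have p2 : ω ^ k * ω ^ (k + e) = ω ^ (k + (k + e)) := by ring
    have p3 : ω⁻¹ ^ k * ω⁻¹ ^ (k + e) = ω⁻¹ ^ (k + (k + e)) := by ring
    have p4 : ω⁻¹ ^ k * ω ^ (k + e) = ω ^ e := by
      rw [pow_add, inv_pow]; field_simp
    have expand : (((r ^ k : ℝ) : ℂ) * ω ^ k + ((r⁻¹ ^ k : ℝ) : ℂ) * ω⁻¹ ^ k) *
        (((r ^ (k + e) : ℝ) : ℂ) * ω⁻¹ ^ (k + e) + ((r⁻¹ ^ (k + e) : ℝ) : ℂ) * ω ^ (k + e)) =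
        ((r ^ k * r ^ (k + e) : ℝ) : ℂ) * (ω ^ k * ω⁻¹ ^ (k + e)) + ((r ^ k * r⁻¹ ^ (k + e) : ℝ) : ℂ) * (ω ^ k * ω ^ (k + e)) +
          ((r⁻¹ ^ k * r ^ (k + e) : ℝ) : ℂ) * (ω⁻¹ ^ k * ω⁻¹ ^ (k + e)) +
          ((r⁻¹ ^ k * r⁻¹ ^ (k + e) : ℝ) : ℂ) * (ω⁻¹ ^ k * ω ^ (k + e)) := by
      push_cast; ring
    rw [expand, p1, p2, p3, p4]
    simp only [Complex.add_re, Complex.re_ofReal_mul]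
    rw [hReinv e, hRe (k + (k + e)), hReinv (k + (k + e)), hRe e, hCsum, hCdiff]
    have q1 : r ^ k * r⁻¹ ^ (k + e) = r⁻¹ ^ e := by rw [pow_add, inv_pow, inv_pow]; field_simp
    have q2 : r⁻¹ ^ k * r ^ (k + e) = r ^ e := by rw [pow_add, inv_pow]; field_simp
    have q3 : r ^ k * r ^ (k + e) = r ^ (k + (k + e)) := by ring
    have q4 : r⁻¹ ^ k * r⁻¹ ^ (k + e) = r⁻¹ ^ (k + (k + e)) := by ring
    rw [q1, q2, q3, q4]
    ring

/-- **`‖q̂_v(z)‖² = H_v(u, w)`** with `u = ‖z‖ + ‖z‖⁻¹`, `w = 2 Re z/‖z‖`, for `z ≠ 0` and nonempty `v`. -/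
theorem norm_sq_qhat_eq_hUW (v : List ℤ) (hv : v ≠ []) {z : ℂ} (hz : z ≠ 0) :
    ‖qhat v z‖ ^ 2 = hUW (v.map (Int.cast : ℤ → ℝ)) (‖z‖ + ‖z‖⁻¹) (2 * (z.re / ‖z‖)) := by
  set vr := v.map (Int.cast : ℤ → ℝ) with hvr
  have hvr0 : vr ≠ [] := by rw [hvr]; simpa using hv
  have hq : qhat v z = ∑ k ∈ Finset.range vr.length, ((lamHalf vr k : ℝ) : ℂ) * (z ^ k + z⁻¹ ^ k) := by
    unfold qhat; rw [← hvr]; exact laurent_vEval_lamHalf vr hz hvr0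
  have h1 : ‖qhat v z‖ ^ 2 = (qhat v z * (starRingEnd ℂ) (qhat v z)).re := by
    rw [Complex.mul_conj, Complex.ofReal_re, Complex.normSq_eq_norm_sq]
  rw [h1, hq, map_sum, Finset.sum_mul_sum, Complex.re_sum]
  unfold hUW
  apply Finset.sum_congr rfl
  intro i _
  rw [Complex.re_sum]
  apply Finset.sum_congr rfl
  intro j _
  rw [map_mul, Complex.conj_ofReal,
    show ((lamHalf vr i : ℝ) : ℂ) * (z ^ i + z⁻¹ ^ i) * (((lamHalf vr j : ℝ) : ℂ) * (starRingEnd ℂ) (z ^ j + z⁻¹ ^ j)) =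
      ((lamHalf vr i * lamHalf vr j : ℝ) : ℂ) * ((z ^ i + z⁻¹ ^ i) * (starRingEnd ℂ) (z ^ j + z⁻¹ ^ j)) by push_cast; ring,
    Complex.re_ofReal_mul, re_X_mul_conj_X hz i j]

/-- The rectangle form of (H) implies `AuxBound`. -/
theorem auxBound_of_uw (a : List ℤ) (qs : List (List ℤ × ℚ)) {B m₀ c : ℝ}
    (hne : ∀ j < qs.length, (qs.getD j ([], 0)).1 ≠ [])
    (h : ∀ u w : ℝ, 2 ≤ u → u ≤ B + B⁻¹ → -2 ≤ w → w ≤ 2 →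
      (∀ j < qs.length, 0 < hUW ((qs.getD j ([], 0)).1.map (Int.cast : ℤ → ℝ)) u w) →
      -m₀ - c * Real.sqrt (u - 2) ≤
        ∑ k ∈ Finset.range a.length, ((a.getD k 0 : ℤ) : ℝ) * (chebC (k + 1) u * chebC (k + 1) w / 4) -
          ∑ j ∈ Finset.range qs.length, (((qs.getD j ([], 0)).2 : ℚ) : ℝ) / 2 *
            Real.log (hUW ((qs.getD j ([], 0)).1.map (Int.cast : ℤ → ℝ)) u w)) :
    AuxBound a qs B m₀ c := by
  intro z hz1 hzB hnz
  have hz : z ≠ 0 := by rintro rfl; norm_num at hz1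
  have hr : 0 < ‖z‖ := norm_pos_iff.mpr hz
  set u := ‖z‖ + ‖z‖⁻¹ with hu
  set w := 2 * (z.re / ‖z‖) with hw
  have hu2 : 2 ≤ u := by
    rw [hu]
    have hinv : 0 < ‖z‖⁻¹ := inv_pos.mpr hr
    have h1 : ‖z‖ * ‖z‖⁻¹ = 1 := mul_inv_cancel₀ hr.ne'
    nlinarith [sq_nonneg (‖z‖ - 1), sq_nonneg (‖z‖⁻¹ - 1), mul_pos hr hinv]
  have huB : u ≤ B + B⁻¹ := by
    rw [hu]
    have := pow_add_inv_pow_le hz1 hzB 1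
    simpa using this
  have hwle : -2 ≤ w ∧ w ≤ 2 := by
    have habs : |z.re| ≤ ‖z‖ := Complex.abs_re_le_norm z
    have h1 : |z.re / ‖z‖| ≤ 1 := by
      rw [abs_div, abs_of_pos hr]; exact (div_le_one hr).mpr habs
    rw [hw]; constructor <;> [have := (abs_le.mp h1).1; have := (abs_le.mp h1).2] <;> linarith
  have hH : ∀ j < qs.length, hUW ((qs.getD j ([], 0)).1.map (Int.cast : ℤ → ℝ)) u w = ‖qhat (qs.getD j ([], 0)).1 z‖ ^ 2 :=
    fun j hj => (norm_sq_qhat_eq_hUW _ (hne j hj) hz).symm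
  have hHpos : ∀ j < qs.length, 0 < hUW ((qs.getD j ([], 0)).1.map (Int.cast : ℤ → ℝ)) u w := by
    intro j hj; rw [hH j hj]; exact pow_pos (norm_pos_iff.mpr (hnz j hj)) 2
  have key := h u w hu2 huB hwle.1 hwle.2 hHpos
  have hsq : Real.sqrt (u - 2) = Real.sqrt (‖z‖ + ‖z‖⁻¹ - 2) := by rw [hu]
  rw [hsq] at key
  refine key.trans (le_of_eq ?_)
  unfold auxF
  congr 1
  · apply Finset.sum_congr rfl
    intro k _
    rw [re_pow_add_inv_pow_eq_chebC hz (k + 1)]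
    ring
  · apply Finset.sum_congr rfl
    intro j hj
    rw [Finset.mem_range] at hj
    rw [hH j hj, Real.log_pow, Nat.cast_ofNat]
    ring

end Summit.Ventures.DiscreteObjects.Mahler
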